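import Summits.Ventures.PercRepro.TypeIdentityHolds

/-!
# PercRepro — Lemma 5 as a sum over classes: `−Q⁺(Δ_g, Δ_g) = Σ_{(u,v)} w(u,v) · S(u,v)` (typer-2, gen 4)

`LEAD-C011-concavity.md` §10.9–§10.15 and ASSIGNMENTS v24 (2): the concavity slack of `Φ⁺` along an
edge `g` is a sum over the CLASSES of the two-copy sum — a class is a pair `(u, v)` with `v ≤ u`
(`u` = join, `v` = meet of the two copies): the edges of `v` are SURE (open in both copies), the
edges outside `u` are CLOSED (in both), and the free edges `Face u v` are those on which the two
copies differ (the lead writes a class as `(sure set, differing set D)`; the class is the minor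
`G′/v − uᶜ` with all its edges free). The class has a single weight
`w(u, v) = w(u) w(v) = Π_sure p² · Π_free p(1−p) · Π_closed (1−p)²` (log-modularity), and a purely
combinatorial CLASS SUM `S(u, v)` = minus the antipodal sum of the merge kernel
`Q⁺(m(ω), m(ω′))` over the ordered antipodal pairs of the face cube (each `Q⁺` entry of the §2
sign table is `±½`, so `S` = #negative − #positive unordered pairs, every pair with weight `1`).

* `classSum`, `classWeight`, **`lemma5_eq_sum_classes`** (`deltaQuad_eq_sum_sum` ∘ `twoCopy_eq_sum_faces`);
  `classWeight_eq_zero_of_open` (classes with `g` open have weight `0`);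
* the named shapes: `ClassSumNonneg` (the class-level principle — FALSE, p6 04:23Z: gadget
  classes have `S = −1`; kept as the shape only) with `EdgeQuadNonpos_of_ClassSumNonneg`;
  **`ConjectureR`** (the lead's conjecture R, §10.14: positive class mass ≥ 2 × negative class mass
  on every mark-incident free edge) with **`Concavity5Sure_of_ConjectureR`** and `C011_of_ConjectureR`;
* the CHOICE versions of Lemma 5 (ASSIGNMENTS v24 (1)): `Concavity5SureChoice`,
  **`Concavity5MarkSureChoice`** — the prover may pick the mark-incident free edge per `(G, p)` —
  with **`C011_of_Concavity5SureChoice`** and **`C011_of_Concavity5MarkSureChoice'`** (no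
  hypothesis beyond the choice statement; `TypeIdentity_holds`).
-/

namespace PercRepro

open Finset

namespace MultiGraph

variable {V E : Type*} (G : MultiGraph V E) [Fintype E] [DecidableEq E]

/-- **The class sum `S(u, v)`** of the class `(join u, meet v)` along the edge `g` (the lead's
`S(u, D)` with `D = Face u v`): minus the sum of `Q⁺(m(ω), m(ω′))` over the ordered antipodal
pairs `(ω, ω′) = (embed ρ, embed ρᶜ)` of the face cube. Combinatorial: no `p` involved. -/
noncomputable def classSum (g : E) (m : Fin 4 → V) (u v : Config E) : ℝ :=
  -∑ ρ : Config (Face u v),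
    quadPlus (G.mergeVecM g m (embed u v ρ)) (G.mergeVecM g m (embed u v ρᶜ))

end MultiGraph

/-- The weight of a class `(u, v)`: `w(u) w(v)`. -/
noncomputable def classWeight {E : Type*} [Fintype E] (p : E → ℝ) (u v : Config E) : ℝ :=
  weight p u * weight p v

section ClassWeight

variable {E : Type*} [Fintype E] [DecidableEq E]

/-- Under `p[g := 0]` a class with `g` open in its join has weight `0`. -/
theorem classWeight_eq_zero_of_open (p : E → ℝ) (g : E) {u v : Config E} (hu : u g = true) :
    classWeight (Function.update p g 0) u v = 0 := by
  unfold classWeight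
  rw [weight_eq_zero_of_open_of_eq_zero (Function.update_self g 0 p) hu, zero_mul]

omit [DecidableEq E] in
/-- Class weights are nonnegative. -/
theorem classWeight_nonneg {p : E → ℝ} (hp : IsProb p) (u v : Config E) :
    0 ≤ classWeight p u v :=
  mul_nonneg (weight_nonneg hp u) (weight_nonneg hp v)

end ClassWeight

namespace MultiGraph

variable {V E : Type*} (G : MultiGraph V E) [Fintype E] [DecidableEq E]

open Classical in
/-- `Q⁺(Δ_g, Δ_g)` grouped by join and meet (the instance of `twoCopy_eq_sum_faces` at the merge
kernel). -/
theorem deltaQuad_eq_sum_faces (p : E → ℝ) (g : E) (a b c d : V) :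
    G.deltaQuad p g a b c d = ∑ uv : Config E × Config E,
      weight (Function.update p g 0) uv.2 * weight (Function.update p g 0) uv.1 *
        if uv.2 ≤ uv.1 then ∑ ρ : Config (Face uv.1 uv.2),
          quadPlus (G.mergeVecM g ![a, b, c, d] (embed uv.1 uv.2 ρ))
            (G.mergeVecM g ![a, b, c, d] (embed uv.1 uv.2 ρᶜ)) else 0 := by
  rw [G.deltaQuad_eq_sum_sum]
  exact twoCopy_eq_sum_faces _ _ _

open Classical in
/-- **Lemma 5 as a sum over classes**: the concavity slack `−Q⁺(Δ_g, Δ_g)` of `Φ⁺` along `g` is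
`Σ_{(u, v), v ≤ u} w_{p[g:=0]}(u, v) · S(u, v)`. -/
theorem lemma5_eq_sum_classes (p : E → ℝ) (g : E) (a b c d : V) :
    -G.deltaQuad p g a b c d = ∑ uv : Config E × Config E,
      if uv.2 ≤ uv.1 then
        classWeight (Function.update p g 0) uv.1 uv.2 * G.classSum g ![a, b, c, d] uv.1 uv.2
      else 0 := by
  rw [G.deltaQuad_eq_sum_faces, ← Finset.sum_neg_distrib]
  refine Finset.sum_congr rfl fun uv _ => ?_
  unfold classSum classWeight
  split_ifs <;> ring

open Classical in
/-- The same, restricted to the classes with `g` closed (the others have weight `0`). -/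
theorem lemma5_eq_sum_classes_closed (p : E → ℝ) (g : E) (a b c d : V) :
    -G.deltaQuad p g a b c d = ∑ uv : Config E × Config E,
      if uv.2 ≤ uv.1 ∧ uv.1 g = false then
        classWeight (Function.update p g 0) uv.1 uv.2 * G.classSum g ![a, b, c, d] uv.1 uv.2
      else 0 := by
  rw [G.lemma5_eq_sum_classes]
  refine Finset.sum_congr rfl fun uv _ => ?_
  by_cases hle : uv.2 ≤ uv.1
  · by_cases hg : uv.1 g = false
    · rw [if_pos hle, if_pos ⟨hle, hg⟩]
    · rw [if_pos hle, if_neg (fun h => hg h.2),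
        classWeight_eq_zero_of_open p g (by simpa using hg), zero_mul]
  · rw [if_neg hle, if_neg (fun h => hle h.1)]

end MultiGraph

/-! ### The named shapes: the class-level principle and conjecture R -/

/-- The CLASS-LEVEL principle «every class sum is nonnegative» — **FALSE** (p6 04:23Z, lead §10.9:
the gadget classes have `S = −1`); typed only as the shape that `lemma5_eq_sum_classes` makes
sufficient. -/
def ClassSumNonneg : Prop :=
  ∀ {V E : Type} [Fintype E] [DecidableEq E] (G : MultiGraph V E) (g : E) (a b c d : V)
    (u v : Config E), v ≤ u → 0 ≤ G.classSum g ![a, b, c, d] u v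

open Classical in
/-- Nonnegative class sums would give the concavity lemma along every edge. -/
theorem EdgeQuadNonpos_of_ClassSumNonneg (h : ClassSumNonneg) : EdgeQuadNonpos := by
  intro V E _ _ G p hp a b c d g
  have hsum : 0 ≤ ∑ uv : Config E × Config E,
      (if uv.2 ≤ uv.1 then
        classWeight (Function.update p g 0) uv.1 uv.2 * G.classSum g ![a, b, c, d] uv.1 uv.2
      else 0) := by
    refine Finset.sum_nonneg fun uv _ => ?_
    split_ifs with hle
    · exact mul_nonneg (classWeight_nonneg (hp.update g ⟨le_rfl, zero_le_one⟩) _ _)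
        (h G g a b c d _ _ hle)
    · exact le_rfl
  have := G.lemma5_eq_sum_classes p g a b c d
  linarith

open Classical in
/-- **Conjecture R** (lead §10.14–§10.15, the natural strengthened target of Lemma 5): on every
mark-incident free edge of every minor, the positive class mass is at least twice the negative
one, `Σ_{S > 0} S·w ≥ 2 · Σ_{S < 0} |S|·w` (positive / negative parts `max S 0`, `max (−S) 0`).
CLASS-LEVEL by construction (the product-level «doubled negative kernel» is false, §10.15).
Exact on the n ≤ 6 catalogue (min ratio 2.004 on the gadget). -/
def ConjectureR : Prop :=
  ∀ {V E : Type} [Fintype E] [DecidableEq E] (G : MultiGraph V E) (p : E → ℝ), IsProb p →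
    ∀ (a b c d : V), [a, b, c, d].Nodup → ∀ g : E, IsFree p g →
      (∃ m, (m = a ∨ m = b ∨ m = c ∨ m = d) ∧
        (G.SureConn p (G.fst g) m ∨ G.SureConn p (G.snd g) m)) →
      2 * (∑ uv : Config E × Config E, if uv.2 ≤ uv.1 then
          classWeight (Function.update p g 0) uv.1 uv.2 *
            max (-G.classSum g ![a, b, c, d] uv.1 uv.2) 0 else 0) ≤
        ∑ uv : Config E × Config E, if uv.2 ≤ uv.1 then
          classWeight (Function.update p g 0) uv.1 uv.2 *
            max (G.classSum g ![a, b, c, d] uv.1 uv.2) 0 else 0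

/-- `max S 0 − max (−S) 0 = S`. -/
private theorem max_sub_max_neg (S : ℝ) : max S 0 - max (-S) 0 = S := by
  rcases le_total 0 S with h | h
  · rw [max_eq_left h, max_eq_right (neg_nonpos.mpr h)]
    ring
  · rw [max_eq_right h, max_eq_left (neg_nonneg.mpr h)]
    ring

open Classical in
/-- **Conjecture R gives Lemma 5 in free-edge form** (even with the factor `2` replaced by `1`). -/
theorem Concavity5Sure_of_ConjectureR (hR : ConjectureR) : Concavity5Sure := by
  intro V E _ _ G p hp a b c d hn g hg hm
  rw [G.concaveOn_phiPlus_iff]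
  have hR' := hR G p hp a b c d hn g hg hm
  have hq : IsProb (Function.update p g 0) := hp.update g ⟨le_rfl, zero_le_one⟩
  set P := ∑ uv : Config E × Config E, if uv.2 ≤ uv.1 then
    classWeight (Function.update p g 0) uv.1 uv.2 *
      max (G.classSum g ![a, b, c, d] uv.1 uv.2) 0 else 0 with hP
  set N := ∑ uv : Config E × Config E, if uv.2 ≤ uv.1 then
    classWeight (Function.update p g 0) uv.1 uv.2 *
      max (-G.classSum g ![a, b, c, d] uv.1 uv.2) 0 else 0 with hN
  have hN0 : 0 ≤ N := by
    refine Finset.sum_nonneg fun uv _ => ?_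
    split_ifs
    · exact mul_nonneg (classWeight_nonneg hq _ _) (le_max_right _ _)
    · exact le_rfl
  have hsplit : -G.deltaQuad p g a b c d = P - N := by
    rw [G.lemma5_eq_sum_classes, hP, hN, ← Finset.sum_sub_distrib]
    refine Finset.sum_congr rfl fun uv _ => ?_
    split_ifs
    · rw [← mul_sub, max_sub_max_neg]
    · ring
  linarith

/-- **Conjecture R gives C-005⁺.** -/
theorem C011_of_ConjectureR (hR : ConjectureR) : C011 :=
  C011_of_Concavity5Sure (Concavity5Sure_of_ConjectureR hR)

/-! ### The choice versions of Lemma 5: pick the mark-incident free edge per `(G, p)` -/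

/-- **Lemma 5, free-edge form, CHOICE version**: whenever some free edge has an endpoint
sure-connected to one of four distinct marks, SOME free edge has `t ↦ Φ⁺(p[g := t])` concave.
(The choose-the-edge induction consumes one edge per `(G, p)`; `Concavity5Sure` demands every
mark-incident free edge.) -/
def Concavity5SureChoice : Prop :=
  ∀ {V E : Type} [Fintype E] [DecidableEq E] (G : MultiGraph V E) (p : E → ℝ), IsProb p →
    ∀ (a b c d : V), [a, b, c, d].Nodup →
      (∃ g : E, IsFree p g ∧ ∃ m, (m = a ∨ m = b ∨ m = c ∨ m = d) ∧
        (G.SureConn p (G.fst g) m ∨ G.SureConn p (G.snd g) m)) →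
      ∃ g : E, IsFree p g ∧
        ConcaveOn ℝ (Set.Icc (0 : ℝ) 1) fun t => G.PhiPlus (Function.update p g t) a b c d

/-- **Lemma 5 on every minor, CHOICE version**: whenever some free edge has an endpoint
sure-connected to one of four distinct marks, SOME such edge satisfies the 6-mark inequality
`sixMarkLHS ≤ sixMarkRHS`. The prover picks the edge per `(G, p)`. -/
def Concavity5MarkSureChoice : Prop :=
  ∀ {V E : Type} [Fintype E] [DecidableEq E] (G : MultiGraph V E) (p : E → ℝ), IsProb p →
    ∀ (a b c d : V), [a, b, c, d].Nodup →
      (∃ g : E, IsFree p g ∧ ∃ m, (m = a ∨ m = b ∨ m = c ∨ m = d) ∧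
        (G.SureConn p (G.fst g) m ∨ G.SureConn p (G.snd g) m)) →
      ∃ g : E, IsFree p g ∧ (∃ m, (m = a ∨ m = b ∨ m = c ∨ m = d) ∧
        (G.SureConn p (G.fst g) m ∨ G.SureConn p (G.snd g) m)) ∧
        G.sixMarkLHS p g a b c d ≤ G.sixMarkRHS p g a b c d

/-- The every-edge statement implies the choice statement. -/
theorem Concavity5SureChoice_of_Concavity5Sure (h : Concavity5Sure) : Concavity5SureChoice := by
  intro V E _ _ G p hp a b c d hn hex
  obtain ⟨g, hg, hm⟩ := hex
  exact ⟨g, hg, h G p hp a b c d hn g hg hm⟩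

/-- The every-edge statement implies the choice statement (6-mark form). -/
theorem Concavity5MarkSureChoice_of_Concavity5MarkSure (h : Concavity5MarkSure) :
    Concavity5MarkSureChoice := by
  intro V E _ _ G p hp a b c d hn hex
  obtain ⟨g, hg, hm⟩ := hex
  exact ⟨g, hg, hm, h G p hp a b c d hn g hg hm⟩

/-- With the type identity the 6-mark choice statement is the concavity choice statement. -/
theorem Concavity5SureChoice_of_Concavity5MarkSureChoice (hid : TypeIdentity)
    (h : Concavity5MarkSureChoice) : Concavity5SureChoice := by
  intro V E _ _ G p hp a b c d hn hex
  obtain ⟨g, hg, -, hle⟩ := h G p hp a b c d hn hex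
  refine ⟨g, hg, ?_⟩
  rw [G.concaveOn_phiPlus_iff, hid G p hp a b c d g]
  linarith

/-- **C-005⁺ from the choice version of Lemma 5** (`C011Induction.lean` steps (0)–(3) with the
edge supplied by the hypothesis instead of by `∃`-elimination). -/
theorem C011_of_Concavity5SureChoice (h5 : Concavity5SureChoice) : C011 := by
  rw [C011_iff_phiPlus_nonneg]
  intro V E _ _ G p hp a b c d
  by_cases hn : [a, b, c, d].Nodup
  swap
  · rw [G.phiPlus_eq_zero_of_not_nodup p hn]
  suffices key : ∀ n : ℕ, ∀ q : E → ℝ, IsProb q → (freeEdges q).card = n →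
      0 ≤ G.PhiPlus q a b c d from key _ p hp rfl
  intro n
  induction n using Nat.strong_induction_on with
  | _ n ih =>
    intro q hq hcard
    by_cases hex : ∃ g, IsFree q g ∧ ∃ m, (m = a ∨ m = b ∨ m = c ∨ m = d) ∧
        (G.SureConn q (G.fst g) m ∨ G.SureConn q (G.snd g) m)
    · obtain ⟨g, hg, hc⟩ := h5 G q hq a b c d hn hex
      have h0 : 0 ≤ G.PhiPlus (Function.update q g 0) a b c d :=
        ih _ (by rw [← hcard]; exact card_freeEdges_update_lt hg (Or.inl rfl)) _
          (hq.update g ⟨le_rfl, zero_le_one⟩) rfl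
      have h1 : 0 ≤ G.PhiPlus (Function.update q g 1) a b c d :=
        ih _ (by rw [← hcard]; exact card_freeEdges_update_lt hg (Or.inr rfl)) _
          (hq.update g ⟨zero_le_one, le_rfl⟩) rfl
      have hg0 : (0 : ℝ) ≤ q g := hq.nonneg g
      have hg1 : q g ≤ 1 := hq.le_one g
      have key := hc.2 (Set.left_mem_Icc.mpr zero_le_one) (Set.right_mem_Icc.mpr zero_le_one)
        (sub_nonneg.mpr hg1) hg0 (by ring)
      simp only [smul_eq_mul, mul_zero, zero_add, mul_one] at key
      rw [Function.update_eq_self g q] at key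
      nlinarith [mul_nonneg (sub_nonneg.mpr hg1) h0, mul_nonneg hg0 h1]
    · push Not at hex
      rw [G.phiPlus_eq_zero_of_noFreeIncident hq hex]

/-- **C-005⁺ from the 6-mark choice version of Lemma 5**, no hypothesis left
(`TypeIdentity_holds`). -/
theorem C011_of_Concavity5MarkSureChoice' (h : Concavity5MarkSureChoice) : C011 :=
  C011_of_Concavity5SureChoice
    (Concavity5SureChoice_of_Concavity5MarkSureChoice TypeIdentity_holds h)

/-- **C-005 from the 6-mark choice version of Lemma 5.** -/
theorem C005_of_Concavity5MarkSureChoice' (h : Concavity5MarkSureChoice) : C005 :=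
  C005_of_C011 (C011_of_Concavity5MarkSureChoice' h)

end PercRepro
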